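import Mathlib.NumberTheory.Cyclotomic.Basic
import Mathlib.NumberTheory.Cyclotomic.Gal
import Mathlib.NumberTheory.Cyclotomic.PrimitiveRoots
import Mathlib.RingTheory.ZMod.UnitsCyclic
import Mathlib.NumberTheory.NumberField.Basic
import Mathlib.FieldTheory.Galois.Basic
import HarnessLib

/-!
# Cyclotomic `2`-power descent over a base field containing `√-1`

Helper file for the crux `HalfIntegralTwistCM` (stmt-Langlands-14036) of the route
`IrreducibilityBySelfDuality`, line `two-primary-chevalley-core`, stub S1b
(`stub_cyclotomicTwoPowerDescent`): if `K` is a number field containing a square root of `-1`,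
`b ≥ 2` and `F = K(ζ_{2^b})`, then an element of `K` which is a `2^b`-th power in `F` is already a
`2^b`-th power in `K`.  (The Grunwald–Wang obstruction `16 = (1+i)^8 ∈ ℚ^{×}` lives exactly at
`K ⊂ K(i)`, which is excluded here.)

Proof (`H¹(Gal(F/K), μ_{2^b}) = 0` by a `2`-adic count).  Write `2^b = 2^(n+2)` and let `ζ` be a
primitive `2^b`-th root of unity in `F`.  The Galois group `G` embeds into `(ℤ/2^b)ˣ` through its
action `g ζ = ζ^{t_g}` (`IsPrimitiveRoot.autToPow`); since `i ∈ K` is fixed, every `t_g ≡ 1 mod 4`,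
so `G` lands in the kernel of `(ℤ/2^b)ˣ → (ℤ/4)ˣ`, which is cyclic (generated by `5`,
`ZMod.orderOf_five`); hence `G = ⟨τ⟩` is cyclic, `τ ζ = ζ^t`, `t - 1 = 2^e m` with `m` odd and
`e ≥ 2`.  From `z^{2^b} = u ∈ K` one gets `τ z = ζ^x z`, and iterating, `τ^k z = ζ^{x S_k} z` with
`S_k = ∑_{j<k} t^j`.  For `k = 2^r`, `r = b - e`, one has `S_k = 2^r · (odd)` (the factors
`1 + t^{2^j}` are `≡ 2 mod 4`), so `τ^k = 1` and `2^b ∣ x S_k` forces `2^e ∣ x`, whence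
`x ≡ (t-1) y mod 2^b` for some `y` (`m` is invertible mod `2^r`).  Then `ζ^{-y} z` is fixed by
`τ`, hence by `G`, hence lies in `K`, and its `2^b`-th power is `u`.  Classical
(Artin–Tate, *Class field theory*, Ch. IX §1). [folklore]
-/

noncomputable section

set_option linter.dupNamespace false -- project-wide option (lakefile weak.linter.dupNamespace); `Summit.Langlands.Langlands` is the mandated namespace

open scoped NumberField

namespace Summit.Langlands.Langlands.Theorems.HalfIntegralTwistCM

/-- **Geometric sums of length `2^r` at `t ≡ 1 mod 4`.**  If `4 ∣ t - 1` and `1 ≤ t` then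
`∑_{j < 2^r} t^j = 2^r · w` with `w` odd (induction on `r`: the sum doubles by the factor
`1 + t^{2^r} ≡ 2 mod 4`). [folklore] -/
theorem geom_sum_two_pow_eq_two_pow_mul_odd (t : ℕ) (ht : 4 ∣ t - 1) (h1 : 1 ≤ t) :
    ∀ r : ℕ, ∃ w, Odd w ∧ ∑ j ∈ Finset.range (2 ^ r), t ^ j = 2 ^ r * w
  | 0 => ⟨1, odd_one, by simp⟩
  | r + 1 => by
    obtain ⟨w, hw, hS⟩ := geom_sum_two_pow_eq_two_pow_mul_odd t ht h1 r
    obtain ⟨k, hk⟩ := ht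
    have ht' : t = 4 * k + 1 := by omega
    have hpow : t ^ 2 ^ r % 4 = 1 := by
      rw [Nat.pow_mod, ht', show (4 * k + 1) % 4 = 1 by omega, one_pow]
      rfl
    obtain ⟨j, hj⟩ : ∃ j, t ^ 2 ^ r = 4 * j + 1 := ⟨t ^ 2 ^ r / 4, by omega⟩
    refine ⟨w * (2 * j + 1), hw.mul (odd_two_mul_add_one j), ?_⟩
    rw [pow_succ, mul_two, Finset.sum_range_add]
    simp_rw [pow_add, ← Finset.mul_sum, hS, hj]
    ring

/-- **The automorphisms fixing `√-1` act on `μ_{2^{n+2}}` through `1 + 4ℤ`.**  If `ζ` is a primitive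
`N`-th root of unity with `N = 4 · 2^n`, `(ζ^c)^2 = -1` (and `2 ≠ 0`), and `ζ^{s c} = ζ^c` with
`1 ≤ s`, then `4 ∣ s - 1`: indeed `c = 2^n c'` with `c'` odd and `N ∣ (s-1) c`. [folklore] -/
theorem four_dvd_sub_one_of_pow_mul_eq {F : Type*} [Field F] {N n : ℕ} (hN : N = 4 * 2 ^ n)
    {ζ : F} (hζ : IsPrimitiveRoot ζ N) {c s : ℕ} (hs : 1 ≤ s) (hI : (ζ ^ c) ^ 2 = -1)
    (h2 : (2 : F) ≠ 0) (hfix : ζ ^ (s * c) = ζ ^ c) : 4 ∣ s - 1 := by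
  have h4c : N ∣ c * 4 := by
    rw [← hζ.pow_eq_one_iff_dvd, pow_mul, show (4 : ℕ) = 2 * 2 from rfl, pow_mul, hI]
    norm_num
  have h2c : ¬ N ∣ c * 2 := by
    rw [← hζ.pow_eq_one_iff_dvd, pow_mul, hI]
    intro h
    apply h2
    linear_combination -h
  have hsc : N ∣ (s - 1) * c := by
    have h := ((hζ.isOfFinOrder (by subst hN; positivity)).pow_eq_pow_iff_modEq).1 hfix
    rw [← hζ.eq_orderOf] at h
    have := (Nat.modEq_iff_dvd' (Nat.le_mul_of_pos_left c hs)).1 h.symm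
    rwa [Nat.sub_mul, one_mul]
  subst hN
  obtain ⟨c', rfl⟩ : 2 ^ n ∣ c := by
    have : 4 * 2 ^ n ∣ 4 * c := by rwa [mul_comm c 4] at h4c
    exact (mul_dvd_mul_iff_left (by norm_num : (4:ℕ) ≠ 0)).1 this
  have hodd : Odd c' := by
    rw [← Nat.not_even_iff_odd]
    rintro ⟨c'', hc''⟩
    apply h2c
    exact ⟨c'', by rw [hc'']; ring⟩
  have h4 : 4 ∣ (s - 1) * c' := by
    have : 2 ^ n * 4 ∣ 2 ^ n * ((s - 1) * c') := by
      convert hsc using 1 <;> ring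
    exact (mul_dvd_mul_iff_left (pow_ne_zero n two_ne_zero)).1 this
  have hcop : Nat.Coprime 4 c' := by
    have := Nat.Coprime.pow_left 2 hodd.coprime_two_left
    norm_num at this
    exact this
  exact hcop.dvd_of_dvd_mul_right h4

/-- **The subgroup `1 + 4ℤ/2^{n+2}ℤ` of `(ℤ/2^{n+2})ˣ` is cyclic.**  The kernel of the reduction
`(ZMod (2^(n+2)))ˣ → (ZMod 4)ˣ` has order `2^(n+1)/2 = 2^n` and contains `5`, which has order
`2^n` (`ZMod.orderOf_five`); so it is generated by `5`. [folklore] -/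
theorem isCyclic_ker_unitsMap_four (n : ℕ) (h4 : 4 ∣ 2 ^ (n + 2)) :
    IsCyclic (ZMod.unitsMap h4).ker := by
  have h5 : Nat.Coprime 5 (2 ^ (n + 2)) := Nat.Coprime.pow_right _ (by norm_num)
  set five : (ZMod (2 ^ (n + 2)))ˣ := ZMod.unitOfCoprime 5 h5 with hfive
  have hle : Subgroup.zpowers five ≤ (ZMod.unitsMap h4).ker := by
    rw [Subgroup.zpowers_le, MonoidHom.mem_ker]
    ext
    rw [ZMod.unitsMap_val, hfive, ZMod.coe_unitOfCoprime, ZMod.cast_natCast h4, Units.val_one]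
    decide
  have hz : Nat.card (Subgroup.zpowers five) = 2 ^ n := by
    rw [Nat.card_zpowers, ← orderOf_units, hfive, ZMod.coe_unitOfCoprime, Nat.cast_ofNat]
    exact ZMod.orderOf_five n
  have hk : Nat.card (ZMod.unitsMap h4).ker = 2 ^ n := by
    have h1 := Subgroup.card_mul_index (ZMod.unitsMap h4).ker
    rw [Subgroup.index_ker, MonoidHom.range_eq_top.2 (ZMod.unitsMap_surjective h4),
      Subgroup.card_top, Nat.card_eq_fintype_card (α := (ZMod 4)ˣ), ZMod.card_units_eq_totient,
      Nat.card_eq_fintype_card (α := (ZMod (2 ^ (n + 2)))ˣ), ZMod.card_units_eq_totient,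
      Nat.totient_prime_pow Nat.prime_two (Nat.succ_pos _)] at h1
    have h4t : Nat.totient 4 = 2 := by decide
    rw [h4t, show n + 2 - 1 = n + 1 from rfl, (pow_succ 2 n : 2 ^ (n + 1) = 2 ^ n * 2)] at h1
    omega
  have heq := Subgroup.eq_of_le_of_card_ge hle (by rw [hz, hk])
  rw [← heq]
  infer_instance

/-- **Cyclotomic `2`-power descent** (stub S1b of the line `two-primary-chevalley-core`).  Let `K`
be a number field containing a square root of `-1`, `b ≥ 2`, and `F/K` a `{2^b}`-cyclotomic
extension.  If `u ∈ K` is a `2^b`-th power in `F`, then `u` is a `2^b`-th power in `K`.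
(`Gal(F/K) ↪ 1 + 4ℤ/2^bℤ` is cyclic and `H¹(Gal(F/K), μ_{2^b}) = 0` by a `2`-adic valuation
count; see the module docstring.)  Classical: Artin–Tate, *Class field theory*, Ch. IX §1;
Chevalley 1951 §3. [folklore] -/
theorem stub_cyclotomicTwoPowerDescent :
    ∀ (K : Type) [Field K] [NumberField K] (F : Type) [Field F] [NumberField F] [Algebra K F]
      (b : ℕ), 2 ≤ b → (∃ i : K, i ^ 2 = -1) → IsCyclotomicExtension {2 ^ b} K F →
        ∀ (u : K) (z : F), algebraMap K F u = z ^ 2 ^ b → ∃ y : K, u = y ^ 2 ^ b := by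
  intro K _ _ F _ _ _ b hb hi hcyc u z huz
  obtain ⟨n, rfl⟩ : ∃ n, b = n + 2 := ⟨b - 2, by omega⟩
  obtain ⟨i, hi⟩ := hi
  haveI := hcyc
  haveI : IsGalois K F := IsCyclotomicExtension.isGalois {2 ^ (n + 2)} K F
  haveI : FiniteDimensional K F := IsCyclotomicExtension.finiteDimensional {2 ^ (n + 2)} K F
  -- the trivial case `u = 0`
  rcases eq_or_ne u 0 with rfl | hu0
  · exact ⟨0, by simp⟩
  have hz0 : z ≠ 0 := by
    rintro rfl
    apply hu0
    rw [zero_pow (pow_ne_zero _ two_ne_zero), map_eq_zero] at huz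
    exact huz
  set N : ℕ := 2 ^ (n + 2) with hN
  haveI : NeZero N := ⟨pow_ne_zero _ two_ne_zero⟩
  haveI : Fact (1 < N) := ⟨Nat.one_lt_two_pow (by omega)⟩
  have hN4 : N = 4 * 2 ^ n := by rw [hN]; ring
  have h4 : 4 ∣ N := ⟨2 ^ n, hN4⟩
  -- a primitive `2^(n+2)`-th root of unity and the cyclotomic character `f`
  have hζ := IsCyclotomicExtension.zeta_spec N K F
  set ζ := IsCyclotomicExtension.zeta N K F with hζdef
  set f : (F ≃ₐ[K] F) →* (ZMod N)ˣ := hζ.autToPow K with hf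
  have hfinj : Function.Injective f := hζ.autToPow_injective K
  have hfspec : ∀ g : F ≃ₐ[K] F, g ζ = ζ ^ ((f g : (ZMod N)ˣ) : ZMod N).val := fun g =>
    (hζ.autToPow_spec K g).symm
  have hval1 : ∀ g : F ≃ₐ[K] F, 1 ≤ ((f g : (ZMod N)ˣ) : ZMod N).val := fun g =>
    Nat.one_le_iff_ne_zero.2 fun h => (f g).ne_zero ((ZMod.val_eq_zero _).1 h)
  -- `√-1 = ζ^c`
  obtain ⟨c, -, hc⟩ : ∃ c < N, ζ ^ c = algebraMap K F i := hζ.eq_pow_of_pow_eq_one (by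
    rw [show N = 2 * 2 * 2 ^ n by rw [hN]; ring, pow_mul, pow_mul, ← map_pow, hi]
    simp)
  -- every automorphism acts on `ζ` by an exponent `≡ 1 mod 4`
  have hmod4 : ∀ g : F ≃ₐ[K] F, 4 ∣ ((f g : (ZMod N)ˣ) : ZMod N).val - 1 := by
    intro g
    refine four_dvd_sub_one_of_pow_mul_eq (c := c) hN4 hζ (hval1 g) ?_ two_ne_zero ?_
    · rw [hc, ← map_pow, hi, map_neg, map_one]
    · rw [pow_mul, ← hfspec g, ← map_pow, hc, AlgEquiv.commutes]
  -- hence the Galois group is cyclic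
  haveI : IsCyclic (F ≃ₐ[K] F) := by
    haveI := isCyclic_ker_unitsMap_four n h4
    have hmem : ∀ g : F ≃ₐ[K] F, f g ∈ (ZMod.unitsMap h4).ker := by
      intro g
      rw [MonoidHom.mem_ker]
      ext
      rw [ZMod.unitsMap_val, Units.val_one, ← ZMod.natCast_zmod_val ((f g : (ZMod N)ˣ) : ZMod N),
        ZMod.cast_natCast h4]
      obtain ⟨k, hk⟩ := hmod4 g
      have h1 := hval1 g
      have : ((f g : (ZMod N)ˣ) : ZMod N).val = 4 * k + 1 := by omega
      rw [this, Nat.cast_add, Nat.cast_mul, Nat.cast_one, ZMod.natCast_self, zero_mul, zero_add]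
    refine isCyclic_of_injective (f.codRestrict (ZMod.unitsMap h4).ker hmem) ?_
    intro g₁ g₂ h
    exact hfinj (congrArg Subtype.val h)
  -- a generator `τ`, `τ ζ = ζ ^ t`
  obtain ⟨τ, hτ⟩ := IsCyclic.exists_monoid_generator (α := F ≃ₐ[K] F)
  set t : ℕ := ((f τ : (ZMod N)ˣ) : ZMod N).val with ht
  have hτζ : τ ζ = ζ ^ t := hfspec τ
  have ht1 : 1 ≤ t := hval1 τ
  have htN : t < N := ZMod.val_lt _
  have hpow_congr : ∀ a d : ℕ, ((a : ℕ) : ZMod N) = d → ζ ^ a = ζ ^ d := fun a d h => by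
    rw [(hζ.isOfFinOrder (NeZero.ne N)).pow_eq_pow_iff_modEq, ← hζ.eq_orderOf]
    exact (ZMod.natCast_eq_natCast_iff a d N).1 h
  -- the cocycle: `τ z = ζ ^ x * z`
  have hτzN : (τ z) ^ N = z ^ N := by rw [← map_pow, ← huz, AlgEquiv.commutes]
  obtain ⟨x, -, hx⟩ : ∃ x < N, ζ ^ x = τ z / z :=
    hζ.eq_pow_of_pow_eq_one (by rw [div_pow, hτzN, div_self (pow_ne_zero _ hz0)])
  have hτz : τ z = ζ ^ x * z := by rw [← (eq_div_iff hz0).1 hx]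
  have hiter : ∀ k : ℕ, (τ ^ k) z = ζ ^ (x * ∑ j ∈ Finset.range k, t ^ j) * z := by
    intro k
    induction k with
    | zero => simp
    | succ k ih =>
      rw [pow_succ', AlgEquiv.mul_apply, ih, map_mul, map_pow, hτζ, hτz, ← pow_mul, ← mul_assoc,
        ← pow_add, geom_sum_succ]
      congr 2
      ring
  -- an element fixed by `τ` is fixed by the whole group, hence lies in `K`
  have hdescend : ∀ w : F, τ w = w → w ^ N = z ^ N → ∃ y : K, u = y ^ N := by
    intro w hw hwN
    have hfix : ∀ g : F ≃ₐ[K] F, g w = w := by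
      intro g
      obtain ⟨k, rfl⟩ := (Submonoid.mem_powers_iff _ _).1 (hτ g)
      induction k with
      | zero => simp
      | succ k ih => rw [pow_succ, AlgEquiv.mul_apply, hw, ih]
    obtain ⟨y₀, hy₀⟩ := (IsGalois.mem_range_algebraMap_iff_fixed w).2 hfix
    refine ⟨y₀, (algebraMap K F).injective ?_⟩
    rw [map_pow, hy₀, hwN, huz]
  -- case `t = 1`: `τ = 1`
  rcases eq_or_lt_of_le ht1 with ht1' | ht1'
  · have hτ1 : τ = 1 := hfinj (by
      ext
      rw [map_one, Units.val_one, ← ZMod.natCast_zmod_val ((f τ : (ZMod N)ˣ) : ZMod N), ← ht,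
        ← ht1', Nat.cast_one])
    exact hdescend z (by rw [hτ1, AlgEquiv.one_apply]) rfl
  -- case `t > 1`: `t - 1 = 2^e m`, `m` odd, `2 ≤ e ≤ n + 2`
  obtain ⟨e, m, hm, hem⟩ := Nat.exists_eq_two_pow_mul_odd (n := t - 1) (by omega)
  have he2 : 2 ≤ e := by
    have h4' : 2 ^ 2 ∣ 2 ^ e * m := by rw [← hem]; simpa using hmod4 τ
    have : 2 ^ 2 ∣ 2 ^ e := (Nat.Coprime.pow_left 2 hm.coprime_two_left).dvd_of_dvd_mul_right h4'
    exact (Nat.pow_dvd_pow_iff_le_right (by norm_num)).1 this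
  have heN : e ≤ n + 2 := by
    have h1 : 2 ^ e ≤ t - 1 := hem ▸ Nat.le_mul_of_pos_right _ hm.pos
    have h2 : 2 ^ e < 2 ^ (n + 2) := by omega
    exact ((Nat.pow_lt_pow_iff_right (by norm_num)).1 h2).le
  obtain ⟨r, hr⟩ : ∃ r, n + 2 = e + r := ⟨n + 2 - e, by omega⟩
  have hNer : N = 2 ^ e * 2 ^ r := by rw [hN, hr, pow_add]
  have ht_eq : t = 2 ^ e * m + 1 := by omega
  obtain ⟨w, hw, hS⟩ := geom_sum_two_pow_eq_two_pow_mul_odd t (hmod4 τ) ht1 r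
  -- `τ ^ 2^r = 1`
  have hτq : τ ^ 2 ^ r = 1 := by
    apply hfinj
    rw [map_pow, map_one]
    ext
    rw [Units.val_pow_eq_pow_val, Units.val_one,
      ← ZMod.natCast_zmod_val ((f τ : (ZMod N)ˣ) : ZMod N), ← ht]
    have key := geom_sum_mul (t : ZMod N) (2 ^ r)
    have hSum : (∑ j ∈ Finset.range (2 ^ r), (t : ZMod N) ^ j) = ((2 ^ r * w : ℕ) : ZMod N) := by
      rw [← hS]
      push_cast
      rfl
    have htsub : (t : ZMod N) - 1 = ((2 ^ e * m : ℕ) : ZMod N) := by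
      rw [← hem, Nat.cast_sub ht1, Nat.cast_one]
    rw [hSum, htsub, ← Nat.cast_mul, show 2 ^ r * w * (2 ^ e * m) = N * (w * m) by rw [hNer]; ring,
      Nat.cast_mul, ZMod.natCast_self, zero_mul] at key
    exact sub_eq_zero.1 key.symm
  -- `2^(n+2) ∣ x · S`, hence `2^e ∣ x`
  have hone : ζ ^ (x * ∑ j ∈ Finset.range (2 ^ r), t ^ j) = 1 := by
    have := hiter (2 ^ r)
    rw [hτq, AlgEquiv.one_apply] at this
    exact (mul_eq_right₀ hz0).1 this.symm
  have hdvd : N ∣ x * (2 ^ r * w) := by rw [← hS, ← hζ.pow_eq_one_iff_dvd]; exact hone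
  have hex : 2 ^ e ∣ x := by
    have h1 : 2 ^ r * 2 ^ e ∣ 2 ^ r * (x * w) := by
      rw [show 2 ^ r * 2 ^ e = N by rw [hNer, mul_comm],
        show 2 ^ r * (x * w) = x * (2 ^ r * w) by ring]
      exact hdvd
    exact (Nat.Coprime.pow_left e hw.coprime_two_left).dvd_of_dvd_mul_right
      ((mul_dvd_mul_iff_left (pow_ne_zero r two_ne_zero)).1 h1)
  obtain ⟨x', rfl⟩ := hex
  -- solve `(t - 1) y ≡ x` modulo `2^(n+2)`
  have hmcop : Nat.Coprime m (2 ^ r) := Nat.Coprime.pow_right r hm.coprime_two_right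
  obtain ⟨y, hy⟩ : ∃ y : ℕ, m * y ≡ x' [MOD 2 ^ r] := by
    refine ⟨((((ZMod.unitOfCoprime m hmcop)⁻¹ : (ZMod (2 ^ r))ˣ) : ZMod (2 ^ r)) * x').val, ?_⟩
    rw [← ZMod.natCast_eq_natCast_iff, Nat.cast_mul, ZMod.natCast_zmod_val,
      ← ZMod.coe_unitOfCoprime m hmcop, Units.mul_inv_cancel_left]
  have hty : t * y ≡ y + 2 ^ e * x' [MOD N] := by
    rw [hNer, ht_eq]
    have h1 : 2 ^ e * (m * y) ≡ 2 ^ e * x' [MOD 2 ^ e * 2 ^ r] := Nat.ModEq.mul_left' _ hy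
    calc (2 ^ e * m + 1) * y = y + 2 ^ e * (m * y) := by ring
      _ ≡ y + 2 ^ e * x' [MOD 2 ^ e * 2 ^ r] := Nat.ModEq.add_left _ h1
  have htyZ : (t : ZMod N) * y = y + 2 ^ e * x' := by
    exact_mod_cast (ZMod.natCast_eq_natCast_iff _ _ _).2 hty
  have hN1 : ((N - 1 : ℕ) : ZMod N) = -1 := by
    rw [Nat.cast_sub NeZero.one_le, ZMod.natCast_self, Nat.cast_one, zero_sub]
  -- the corrected root `ζ^(-y) z` is fixed by `τ`
  have hfixτ : τ (ζ ^ (y * (N - 1)) * z) = ζ ^ (y * (N - 1)) * z := by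
    rw [map_mul, map_pow, hτζ, hτz, ← pow_mul, ← mul_assoc, ← pow_add]
    congr 1
    apply hpow_congr
    simp only [Nat.cast_add, Nat.cast_mul, Nat.cast_pow, Nat.cast_ofNat, hN1]
    linear_combination (-1 : ZMod N) * htyZ
  refine hdescend _ hfixτ ?_
  rw [mul_pow, ← pow_mul, (hζ.pow_eq_one_iff_dvd _).2 (Dvd.intro_left _ rfl), one_mul]

end Summit.Langlands.Langlands.Theorems.HalfIntegralTwistCM
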